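import Summits.ResolutionOfSingularities.ResolutionOfSingularities.Theorems.PurelyInseparableDim4ResConeKTwoFiveResiduals
import Summits.ResolutionOfSingularities.ResolutionOfSingularities.Theorems.PurelyInseparableDim4ResConeBInfKeepStep
import Summits.ResolutionOfSingularities.ResolutionOfSingularities.Theorems.PurelyInseparableDim4ResConeBInfLoseStep
import Summits.ResolutionOfSingularities.ResolutionOfSingularities.Theorems.PurelyInseparableDim4E2OfCJSTrichotomyPrime
import HarnessLib
import HarnessLib.Audit.Tags

/-!
# Purely inseparable four-folds — K2(5) and F4-I(5,5) FROM THE THREE PRESENTATION RESIDUALS ONLY: both Φ-line step laws are DISCHARGED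
# (res-dim4-p-7 g4's `ResCone.stub_keep`, res-dim4-p-2 g5's `ResCone.bInf_stub_lose`), so K2(5) ⟸ {hN4-C, hN4-C′, hN4-D} and
# F4-I(5,5) ⟸ CJS Thm 6.40 + the same three (cell `res-dim4-pi`, K2(p) lane holder file, ledger theorem v8.2)

[OURS · counted 0 · cell `res-dim4-pi` · K2(p) lane holder res-dim4-p-12 g4.]  Nothing here proves K2(5) (`RidgeBudget.NoAboveFloorTrap 5 5`),
F4-I (`NoIsolatedTrap 5 5`) or resolution of singularities in dimension ≥ 4 / characteristic `p` — NOT proved: both theorems are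
CONDITIONAL on three named OURS hypotheses of the re-presentation (hN4) type; F4-I also on the published CJS Key Theorem 6.40 as typed
(`KeyTheorem640_char_localized_isolated`, unproved in the tree).  AI kernel work, weaker than expert review.

The ledger theorem v8 (`noAboveFloorTrap_five_of_residuals`, p704409) takes five named residuals; the two Φ-line ONE-STEP LAWS among them
are now tree theorems — the KEEP law `ResCone.stub_keep` (res-dim4-p-7 g4, `…BInfKeepStep`) and the LOSE law `ResCone.bInf_stub_lose`
(res-dim4-p-2 g5, `…BInfLoseStep`), both over res-dim4-p-11 g4's (K-Φ2) dictionary II–XIV and res-dim4-idea-1's CARD I-1-8 — so: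
* **`noAboveFloorTrap_five_of_representations (hN4C) (hN4C') (hN4D)`** — K2(5) from the three re-presentation hypotheses alone: hN4-C
  (every light `(5,3)` binary-cone tail has a loss-free re-presentation), hN4-C′ (same for the light pair at `(5,4)`), hN4-D (every D∞ `(5,4)`
  tail has a pair-confined passive-free re-presentation); binders = `…RepresentationSockets` (p703603) verbatim;
* **`noIsolatedTrap_five_of_representations (hK640) (hN4C) (hN4C') (hN4D)`** — F4-I(5,5) from CJS 6.40 (NoWideTrap, via res-dim4-p-1 g2 /
  res-dim4-p-11's `E2OfCJS.noIsolatedTrap_of_KeyTheorem640_of_noAboveFloorTrap`) and the same three.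
Everything else — slice B, the B∞ assembly with entry/keep/lose laws, weights W/W₄, C13, the pair-tail kill, NarrowDrop — is in the tree.

[cite: CossartJannsenSaito2020, Thm. 3.14, Thm. 6.40, Lemma 13.4, Thm. 13.7] [cite: HauserPerlega2019PRIMS, §2 (transform D′ of D)]
bears_on: LADDER-RESOLUTION:D157-DOOR2 (res-dim4-pi · K2(p) · ledger theorem v8.2).  Supports stmt-ResolutionOfSingularities-16155 (helper).
-/

set_option linter.dupNamespace false -- mandated namespace of this single-conjunct summit

noncomputable section

namespace Summit.ResolutionOfSingularities.ResolutionOfSingularities.Theorems.PIDim4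

namespace ResCone

open MvPolynomial Finset
open Literature.AlgebraicGeometry.Resolution
open Literature.AlgebraicGeometry.Resolution.CentreBlowup
open Literature.AlgebraicGeometry.Resolution.Hauser2010
open Literature.AlgebraicGeometry.Resolution.HauserPerlega2019
open Literature.AlgebraicGeometry.Resolution.WeightedOrder
open RidgeBudget (NoAboveFloorTrap)
open Literature.AlgebraicGeometry.CossartJannsenSaito2020 (KeyTheorem640_char_localized_isolated)

/-- **K2(5) FROM THE THREE PRESENTATION RESIDUALS** (both Φ-line step laws discharged by `ResCone.stub_keep` / `ResCone.bInf_stub_lose`):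
hN4-C (light `(5,3)` loss-free re-presentation), hN4-C′ (light-pair `(5,4)`), hN4-D (D∞ `(5,4)` pair-confinement). [OURS · conditional on
the three named hypotheses] [cite: CossartJannsenSaito2020, Thm. 3.14, Lemma 13.4, Thm. 13.7] -/
theorem noAboveFloorTrap_five_of_representations
    (hN4C : ∀ (K : Type) [Field K] [CharP K 5] [DecidableEq K], 
      ∀ (c : ℕ → State K) (j : ℕ → Fin 4) (b : ℕ → Fin 4 → K),
      (∀ k, IsIsolated 5 (c k).F ∧ Step0 5 (c k) (c (k + 1))) → FreeTail.IsWitnessedChain 5 c j b →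
      (∀ e ∈ (c 0).F.support, (c 0).r ≤ e) → (∀ k, ordZero (c k).F ≠ (5 : ℕ)) →
      ∀ k₀ : ℕ, (∀ k, k₀ ≤ k → (c k).shade = ((3 : ℕ) : ℕ∞)) →
      (∀ k, k₀ ≤ k → Module.finrank K (resVertex (c k)) = 2) →
      (∀ k, k₀ ≤ k → (∀ i, (c k).r i ≤ 1) ∧ (c k).r.degree = 3) →
      ∃ (c' : ℕ → State K) (j' : ℕ → Fin 4) (b' : ℕ → Fin 4 → K) (k₀' : ℕ),
        (∀ k, IsIsolated 5 (c' k).F ∧ Step0 5 (c' k) (c' (k + 1))) ∧ FreeTail.IsWitnessedChain 5 c' j' b' ∧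
        (∀ e ∈ (c' 0).F.support, (c' 0).r ≤ e) ∧ (∀ k, ordZero (c' k).F ≠ (5 : ℕ)) ∧
        (∀ k, k₀' ≤ k → (c' k).shade = ((3 : ℕ) : ℕ∞)) ∧
        (∀ k, k₀' ≤ k → Module.finrank K (resVertex (c' k)) = 2) ∧
        (∀ k, k₀' ≤ k → ∀ i, b' k i ≠ 0 → (c' k).r i = 0))
    (hN4C' : ∀ (K : Type) [Field K] [CharP K 5] [DecidableEq K], 
      ∀ (c : ℕ → State K) (j : ℕ → Fin 4) (b : ℕ → Fin 4 → K),
      (∀ k, IsIsolated 5 (c k).F ∧ Step0 5 (c k) (c (k + 1))) → FreeTail.IsWitnessedChain 5 c j b →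
      (∀ e ∈ (c 0).F.support, (c 0).r ≤ e) → (∀ k, ordZero (c k).F ≠ (5 : ℕ)) →
      ∀ k₀ : ℕ, (∀ k, k₀ ≤ k → (c k).shade = ((4 : ℕ) : ℕ∞)) →
      (∀ k, k₀ ≤ k → Module.finrank K (resVertex (c k)) = 2) →
      (∀ k, k₀ ≤ k → (∀ i, (c k).r i ≤ 1) ∧ (c k).r.degree = 2) →
      ∃ (c' : ℕ → State K) (j' : ℕ → Fin 4) (b' : ℕ → Fin 4 → K) (k₀' : ℕ),
        (∀ k, IsIsolated 5 (c' k).F ∧ Step0 5 (c' k) (c' (k + 1))) ∧ FreeTail.IsWitnessedChain 5 c' j' b' ∧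
        (∀ e ∈ (c' 0).F.support, (c' 0).r ≤ e) ∧ (∀ k, ordZero (c' k).F ≠ (5 : ℕ)) ∧
        (∀ k, k₀' ≤ k → (c' k).shade = ((4 : ℕ) : ℕ∞)) ∧
        (∀ k, k₀' ≤ k → Module.finrank K (resVertex (c' k)) = 2) ∧
        (∀ k, k₀' ≤ k → ∀ i, b' k i ≠ 0 → (c' k).r i = 0))
    (hN4D : ∀ (K : Type) [Field K] [CharP K 5] [DecidableEq K], 
      ∀ (c : ℕ → State K) (j : ℕ → Fin 4) (b : ℕ → Fin 4 → K),
      (∀ k, IsIsolated 5 (c k).F ∧ Step0 5 (c k) (c (k + 1))) → FreeTail.IsWitnessedChain 5 c j b →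
      (∀ e ∈ (c 0).F.support, (c 0).r ≤ e) → (∀ k, ordZero (c k).F ≠ (5 : ℕ)) →
      ∀ k₀ : ℕ, (∀ k, k₀ ≤ k → (c k).shade = ((4 : ℕ) : ℕ∞)) →
      (∀ k, k₀ ≤ k → Module.finrank K (resVertex (c k)) = 2) →
      ∀ k₁ : ℕ, k₀ ≤ k₁ → (∀ k, k₁ ≤ k → (∃ W, (c k).r W = 2 ∧ ∀ i, i ≠ W → (c k).r i ≤ 1) ∧
        (2 ≤ (c k).r.degree ∧ (c k).r.degree ≤ 3)) →
      ∃ (c' : ℕ → State K) (j' : ℕ → Fin 4) (b' : ℕ → Fin 4 → K) (k₀' : ℕ) (a a' : Fin 4),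
        (∀ k, IsIsolated 5 (c' k).F ∧ Step0 5 (c' k) (c' (k + 1))) ∧ FreeTail.IsWitnessedChain 5 c' j' b' ∧
        (∀ e ∈ (c' 0).F.support, (c' 0).r ≤ e) ∧ (∀ k, ordZero (c' k).F ≠ (5 : ℕ)) ∧
        (∀ k, k₀' ≤ k → (c' k).shade = ((4 : ℕ) : ℕ∞)) ∧
        (∀ k, k₀' ≤ k → Module.finrank K (resVertex (c' k)) = 2) ∧ a ≠ a' ∧
        (∀ k, k₀' ≤ k → (j' k = a ∨ j' k = a')) ∧
        (∀ k, k₀' ≤ k → ∀ i, i ≠ a → i ≠ a' → (c' k).r i = 0)) :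
    NoAboveFloorTrap 5 5 :=
  noAboveFloorTrap_five_of_residuals hN4C
    (fun K _ _ _ c j b hc hw hr0 hfloor k₀ hshade he k hk h3 h L M hinv =>
      stub_keep hc hw hr0 (fun k => by exact_mod_cast hfloor k) hshade he hk h3 hinv)
    (fun K _ _ _ c j b hc hw hr0 hfloor k₀ hshade he =>
      bInf_stub_lose hc hw hr0 (fun k => by exact_mod_cast hfloor k) hshade he)
    hN4C' hN4D

/-- **F4-I(5,5) FROM CJS 6.40 AND THE THREE PRESENTATION RESIDUALS**: `NoIsolatedTrap 5 5` — no infinite point-blow-up chain of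
ISOLATED 5-fold points of `z⁵ + F(x₁..x₄)` — follows from the published Key Theorem 6.40 of Cossart–Jannsen–Saito (as typed, feeding
`NoWideTrap`) and hN4-C, hN4-C′, hN4-D. [OURS · conditional on a NAMED PUBLISHED FACT and three named OURS hypotheses]
[cite: CossartJannsenSaito2020, Thm. 6.40, Thm. 3.14] -/
theorem noIsolatedTrap_five_of_representations (hK640 : KeyTheorem640_char_localized_isolated.{0})
    (hN4C : ∀ (K : Type) [Field K] [CharP K 5] [DecidableEq K], 
      ∀ (c : ℕ → State K) (j : ℕ → Fin 4) (b : ℕ → Fin 4 → K),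
      (∀ k, IsIsolated 5 (c k).F ∧ Step0 5 (c k) (c (k + 1))) → FreeTail.IsWitnessedChain 5 c j b →
      (∀ e ∈ (c 0).F.support, (c 0).r ≤ e) → (∀ k, ordZero (c k).F ≠ (5 : ℕ)) →
      ∀ k₀ : ℕ, (∀ k, k₀ ≤ k → (c k).shade = ((3 : ℕ) : ℕ∞)) →
      (∀ k, k₀ ≤ k → Module.finrank K (resVertex (c k)) = 2) →
      (∀ k, k₀ ≤ k → (∀ i, (c k).r i ≤ 1) ∧ (c k).r.degree = 3) →
      ∃ (c' : ℕ → State K) (j' : ℕ → Fin 4) (b' : ℕ → Fin 4 → K) (k₀' : ℕ),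
        (∀ k, IsIsolated 5 (c' k).F ∧ Step0 5 (c' k) (c' (k + 1))) ∧ FreeTail.IsWitnessedChain 5 c' j' b' ∧
        (∀ e ∈ (c' 0).F.support, (c' 0).r ≤ e) ∧ (∀ k, ordZero (c' k).F ≠ (5 : ℕ)) ∧
        (∀ k, k₀' ≤ k → (c' k).shade = ((3 : ℕ) : ℕ∞)) ∧
        (∀ k, k₀' ≤ k → Module.finrank K (resVertex (c' k)) = 2) ∧
        (∀ k, k₀' ≤ k → ∀ i, b' k i ≠ 0 → (c' k).r i = 0))
    (hN4C' : ∀ (K : Type) [Field K] [CharP K 5] [DecidableEq K], 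
      ∀ (c : ℕ → State K) (j : ℕ → Fin 4) (b : ℕ → Fin 4 → K),
      (∀ k, IsIsolated 5 (c k).F ∧ Step0 5 (c k) (c (k + 1))) → FreeTail.IsWitnessedChain 5 c j b →
      (∀ e ∈ (c 0).F.support, (c 0).r ≤ e) → (∀ k, ordZero (c k).F ≠ (5 : ℕ)) →
      ∀ k₀ : ℕ, (∀ k, k₀ ≤ k → (c k).shade = ((4 : ℕ) : ℕ∞)) →
      (∀ k, k₀ ≤ k → Module.finrank K (resVertex (c k)) = 2) →
      (∀ k, k₀ ≤ k → (∀ i, (c k).r i ≤ 1) ∧ (c k).r.degree = 2) →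
      ∃ (c' : ℕ → State K) (j' : ℕ → Fin 4) (b' : ℕ → Fin 4 → K) (k₀' : ℕ),
        (∀ k, IsIsolated 5 (c' k).F ∧ Step0 5 (c' k) (c' (k + 1))) ∧ FreeTail.IsWitnessedChain 5 c' j' b' ∧
        (∀ e ∈ (c' 0).F.support, (c' 0).r ≤ e) ∧ (∀ k, ordZero (c' k).F ≠ (5 : ℕ)) ∧
        (∀ k, k₀' ≤ k → (c' k).shade = ((4 : ℕ) : ℕ∞)) ∧
        (∀ k, k₀' ≤ k → Module.finrank K (resVertex (c' k)) = 2) ∧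
        (∀ k, k₀' ≤ k → ∀ i, b' k i ≠ 0 → (c' k).r i = 0))
    (hN4D : ∀ (K : Type) [Field K] [CharP K 5] [DecidableEq K], 
      ∀ (c : ℕ → State K) (j : ℕ → Fin 4) (b : ℕ → Fin 4 → K),
      (∀ k, IsIsolated 5 (c k).F ∧ Step0 5 (c k) (c (k + 1))) → FreeTail.IsWitnessedChain 5 c j b →
      (∀ e ∈ (c 0).F.support, (c 0).r ≤ e) → (∀ k, ordZero (c k).F ≠ (5 : ℕ)) →
      ∀ k₀ : ℕ, (∀ k, k₀ ≤ k → (c k).shade = ((4 : ℕ) : ℕ∞)) →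
      (∀ k, k₀ ≤ k → Module.finrank K (resVertex (c k)) = 2) →
      ∀ k₁ : ℕ, k₀ ≤ k₁ → (∀ k, k₁ ≤ k → (∃ W, (c k).r W = 2 ∧ ∀ i, i ≠ W → (c k).r i ≤ 1) ∧
        (2 ≤ (c k).r.degree ∧ (c k).r.degree ≤ 3)) →
      ∃ (c' : ℕ → State K) (j' : ℕ → Fin 4) (b' : ℕ → Fin 4 → K) (k₀' : ℕ) (a a' : Fin 4),
        (∀ k, IsIsolated 5 (c' k).F ∧ Step0 5 (c' k) (c' (k + 1))) ∧ FreeTail.IsWitnessedChain 5 c' j' b' ∧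
        (∀ e ∈ (c' 0).F.support, (c' 0).r ≤ e) ∧ (∀ k, ordZero (c' k).F ≠ (5 : ℕ)) ∧
        (∀ k, k₀' ≤ k → (c' k).shade = ((4 : ℕ) : ℕ∞)) ∧
        (∀ k, k₀' ≤ k → Module.finrank K (resVertex (c' k)) = 2) ∧ a ≠ a' ∧
        (∀ k, k₀' ≤ k → (j' k = a ∨ j' k = a')) ∧
        (∀ k, k₀' ≤ k → ∀ i, i ≠ a → i ≠ a' → (c' k).r i = 0)) :
    NoIsolatedTrap 5 5 :=
  haveI : Fact (Nat.Prime 5) := ⟨by norm_num⟩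
  E2OfCJS.noIsolatedTrap_of_KeyTheorem640_of_noAboveFloorTrap 5 (by norm_num) hK640
    (noAboveFloorTrap_five_of_representations hN4C hN4C' hN4D)

end ResCone

end Summit.ResolutionOfSingularities.ResolutionOfSingularities.Theorems.PIDim4

end
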